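import Summits.Ventures.HSemireg.WedgeHankelRecurrenceGaussChristoffelTheorem

/-!
# Venture HSemireg — **UVAROV'S FORMULA (adding a mass point)**: for a positive discrete measure `(ν, w)` with orthogonal polynomials `q_0, …, q_{n+1}` and kernel `K_n(x, c) = Σ_{k≤n} q_k(c) q_k(x) ∕ h_k`,
# the polynomial `q̃_{n+1} = q_{n+1} − M q_{n+1}(c) K_n(·, c) ∕ (1 + M K_n(c, c))` is monic of degree `n + 1` and orthogonal to every `G` with `deg G ≤ n` for the measure `ν + M δ_c`
# (`Σ_l ν_l q̃ G(w_l) + M q̃(c) G(c) = 0`); for a NEW atom `c ∉ {w_l}` with `M > 0` it is THE monic orthogonal polynomial of degree `n + 1` of `ν + M δ_c`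

HONEST FRAMING. Part of the Lean index of the computation cell `pub-hsemireg` (seat p10 gen 43, Sunday typer «UNIFORM-IN-n»).  Real polynomials and finite sums only; no variety, no cohomology
theory, no sheaf, no Ext group and no semiregularity map is constructed here; nothing here says that HC / HC_CM / HC_AV holds; no Literature fact (unproved `Prop`) is declared or used.  Custodian
versions as in `WedgeHankelSiegelIdeal` (1/3).
SOURCES (cited).  V. B. Uvarov, *The connection between systems of polynomials orthogonal with respect to different distribution functions*, USSR Comput. Math. Math. Phys. 9 (1969) 25–36
(English transl. of Ž. Vyčisl. Mat. i Mat. Fiz. 9 (1969) 1253–1262), the case of one added mass; P. Nevai, *Orthogonal Polynomials*, Mem. AMS 213 (1979), Lemma 7.16 ∕ §7; T. S. Chihara, *An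
Introduction to Orthogonal Polynomials* (1978), Ch. I Ex. 7.3; W. Gautschi, *Orthogonal Polynomials: Computation and Approximation* (2004), §2.4.4 (adding a discrete point mass).
PROOF TYPED HERE.  For `deg G ≤ n`: `Σ_l ν_l q_{n+1} G = 0`, `Σ_l ν_l K_n(·, c) G = G(c)` (N277 `kernel_reproducing`), and `q̃(c) = q_{n+1}(c) ∕ (1 + M K_n(c, c))`, so the three terms cancel; monic of degree
`n + 1` since `deg K_n(·, c) ≤ n`; for a new atom the augmented measure `(Fin.cons M ν, Fin.cons c w)` is positive with distinct nodes and N290 `orthogonal_monic_unique` identifies `q̃`.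
DEDUP DISCLOSURE (`rg -n 'uvarov|mass_point|add_atom|Fin.cons M' Summits/Ventures/HSemireg Literature`, 2026-09-03): nothing on adding a point mass to a measure's orthogonal system.  The 4 names
below: 0 hits tree-wide.

WHAT IS IN THE TREE.  N277 `kernel_reproducing`, `natDegree_reproducingKernel_le`; N273 `sum_mul_eval_sq_pos_of_natDegree_lt`; N290 `orthogonal_monic_unique`; Mathlib `Polynomial.Monic.sub_of_left`,
`Polynomial.natDegree_sub_eq_left_of_natDegree_lt`, `Fin.sum_univ_succ`, `Fin.cons_zero`, `Fin.cons_succ`, `Fin.cons_injective_iff`.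
THIS FILE (namespace `Summit.Ventures.HSemireg.Wedge.HankelOuter` continued; CHAINED on N304 (import), N277, N290; 0 definitions — `q̃` written inline):
* §1070 `uvarov_monic_natDegree` (`q̃` is monic of degree `n + 1`), **`uvarov_orthogonal`** (UVAROV: `Σ_l ν_l (q̃ G)(w_l) + M (q̃ G)(c) = 0` for `deg G ≤ n`, any real `M`, `c` with `1 + M K_n(c, c) ≠ 0`),
  `sum_cons_measure` (`Σ` of `P` over `Fin.cons` = the added atom plus the old sum), **`uvarov_theorem`** (for `M > 0` and a new atom `c`: the monic orthogonal polynomial of degree `n + 1` of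
  `ν + M δ_c` — as the discrete measure `(Fin.cons M ν, Fin.cons c w)` — equals `q̃`).
CAVEATS.  One added atom; `1 + M K_n(c, c) ≠ 0` is automatic for `M ≥ 0` (then it is `≥ 1`).  Nothing Ext-side.  New names only.
-/

open Module Polynomial
open scoped Matrix Polynomial

namespace Summit.Ventures.HSemireg.Wedge.HankelOuter

/-! ## §1070. Uvarov: the orthogonal polynomials of `ν + M δ_c` -/

/-- **`q̃ = q_{n+1} − κ K_n(·, c)` is monic of degree `n + 1`** (any scalar `κ`; `deg K_n(·, c) ≤ n`). [mechanism; this file, §1070] -/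
theorem uvarov_monic_natDegree {N : ℕ} (ν w : Fin N → ℝ) {q : ℕ → ℝ[X]} {n : ℕ} (hmonic : ∀ k, k ≤ n + 1 → (q k).Monic) (hdeg : ∀ k, k ≤ n + 1 → (q k).natDegree = k) (c κ : ℝ) :
    (q (n + 1) - C κ * ∑ k ∈ Finset.range (n + 1), C ((q k).eval c / ∑ l, ν l * ((q k).eval (w l)) ^ 2) * q k).Monic ∧
      (q (n + 1) - C κ * ∑ k ∈ Finset.range (n + 1), C ((q k).eval c / ∑ l, ν l * ((q k).eval (w l)) ^ 2) * q k).natDegree = n + 1 := by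
  have hKd := natDegree_reproducingKernel_le (ν := ν) (w := w) (q := q) (n := n) (fun k hk => hdeg k (by omega)) c
  have hlow : (C κ * ∑ k ∈ Finset.range (n + 1), C ((q k).eval c / ∑ l, ν l * ((q k).eval (w l)) ^ 2) * q k).natDegree < (q (n + 1)).natDegree := by
    rw [hdeg (n + 1) le_rfl]
    exact lt_of_le_of_lt ((natDegree_C_mul_le _ _).trans hKd) (Nat.lt_succ_self n)
  refine ⟨(hmonic (n + 1) le_rfl).sub_of_left (degree_lt_degree hlow), ?_⟩
  rw [natDegree_sub_eq_left_of_natDegree_lt hlow, hdeg (n + 1) le_rfl]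

/-- **UVAROV'S FORMULA.**  With `K_n(x, c) = Σ_{k≤n} q_k(c) q_k(x) ∕ h_k` and `κ = M q_{n+1}(c) ∕ (1 + M K_n(c, c))` (`1 + M K_n(c, c) ≠ 0`), the polynomial `q̃ = q_{n+1} − κ K_n(·, c)` is orthogonal
to every `G` of degree `≤ n` for `ν + M δ_c`: `Σ_l ν_l (q̃ G)(w_l) + M (q̃ G)(c) = 0`. [Uvarov 1969; Nevai 1979 §7; Chihara I Ex. 7.3; Gautschi §2.4.4; this file, §1070] -/
theorem uvarov_orthogonal {N m : ℕ} {ν w : Fin N → ℝ} {q : ℕ → ℝ[X]} (hmonic : ∀ k, k ≤ m → (q k).Monic) (hdeg : ∀ k, k ≤ m → (q k).natDegree = k)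
    (horth : ∀ k, k ≤ m → ∀ G : ℝ[X], G.natDegree < k → ∑ l, ν l * (q k * G).eval (w l) = 0) (hh : ∀ k, k ≤ m → ∑ l, ν l * ((q k).eval (w l)) ^ 2 ≠ 0)
    {n : ℕ} (hn : n + 1 ≤ m) {c M : ℝ} (hden : 1 + M * (∑ k ∈ Finset.range (n + 1), C ((q k).eval c / ∑ l, ν l * ((q k).eval (w l)) ^ 2) * q k).eval c ≠ 0)
    {G : ℝ[X]} (hG : G.natDegree ≤ n) :
    ∑ l, ν l * ((q (n + 1) - C (M * (q (n + 1)).eval c / (1 + M * (∑ k ∈ Finset.range (n + 1), C ((q k).eval c / ∑ l, ν l * ((q k).eval (w l)) ^ 2) * q k).eval c)) *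
        ∑ k ∈ Finset.range (n + 1), C ((q k).eval c / ∑ l, ν l * ((q k).eval (w l)) ^ 2) * q k) * G).eval (w l) +
      M * ((q (n + 1) - C (M * (q (n + 1)).eval c / (1 + M * (∑ k ∈ Finset.range (n + 1), C ((q k).eval c / ∑ l, ν l * ((q k).eval (w l)) ^ 2) * q k).eval c)) *
        ∑ k ∈ Finset.range (n + 1), C ((q k).eval c / ∑ l, ν l * ((q k).eval (w l)) ^ 2) * q k) * G).eval c = 0 := by
  set K : ℝ[X] := ∑ k ∈ Finset.range (n + 1), C ((q k).eval c / ∑ l, ν l * ((q k).eval (w l)) ^ 2) * q k with hK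
  set κ : ℝ := M * (q (n + 1)).eval c / (1 + M * K.eval c) with hκ
  have h1 : ∑ l, ν l * (q (n + 1) * G).eval (w l) = 0 := horth (n + 1) hn G (by omega)
  have h2 : ∑ l, ν l * (K * G).eval (w l) = G.eval c := kernel_reproducing hmonic hdeg horth hh (by omega) hG c
  have hsplit : ∀ x : ℝ, ((q (n + 1) - C κ * K) * G).eval x = (q (n + 1) * G).eval x - κ * (K * G).eval x := fun x => by
    simp only [eval_mul, eval_sub, eval_C]; ring
  simp only [hsplit, mul_sub, Finset.sum_sub_distrib]
  rw [h1, show ∑ l, ν l * (κ * (K * G).eval (w l)) = κ * ∑ l, ν l * (K * G).eval (w l) by rw [Finset.mul_sum]; exact Finset.sum_congr rfl fun l _ => by ring, h2, eval_mul, eval_mul]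
  have hκ' : κ * (1 + M * K.eval c) = M * (q (n + 1)).eval c := by rw [hκ, div_mul_cancel₀ _ hden]
  linear_combination (-G.eval c) * hκ'

/-- **Sums over the augmented atom list**: `Σ_{l′} (Fin.cons M ν)_{l′} · P((Fin.cons c w)_{l′}) = M P(c) + Σ_l ν_l P(w_l)`. [mechanism; this file, §1070] -/
theorem sum_cons_measure {N : ℕ} (ν w : Fin N → ℝ) (M c : ℝ) (P : ℝ[X]) :
    ∑ l : Fin (N + 1), (Fin.cons M ν : Fin (N + 1) → ℝ) l * P.eval ((Fin.cons c w : Fin (N + 1) → ℝ) l) = M * P.eval c + ∑ l, ν l * P.eval (w l) := by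
  rw [Fin.sum_univ_succ]
  simp only [Fin.cons_zero, Fin.cons_succ]

/-- **UVAROV'S THEOREM (a new atom).**  Let `ν_l > 0` on `N` distinct nodes `w_l`, `n + 1 < N`, with orthogonal polynomials `q_0, …, q_{n+1}`; let `c ∉ {w_l}` and `M > 0`.  Then the monic
polynomial `Q` of degree `n + 1` which is orthogonal to all lower degrees for the augmented measure `ν + M δ_c = (Fin.cons M ν, Fin.cons c w)` equals
`q_{n+1} − (M q_{n+1}(c) ∕ (1 + M K_n(c, c))) K_n(·, c)`. [Uvarov 1969; Nevai 1979 Lemma 7.16; Gautschi §2.4.4; this file, §1070] -/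
theorem uvarov_theorem {N n : ℕ} {ν w : Fin N → ℝ} (hν : ∀ l, 0 < ν l) (hw : Function.Injective w) (hnN : n + 1 < N) {q : ℕ → ℝ[X]}
    (hmonic : ∀ k, k ≤ n + 1 → (q k).Monic) (hdeg : ∀ k, k ≤ n + 1 → (q k).natDegree = k)
    (horth : ∀ k, k ≤ n + 1 → ∀ G : ℝ[X], G.natDegree < k → ∑ l, ν l * (q k * G).eval (w l) = 0) {c M : ℝ} (hc : ∀ l, w l ≠ c) (hM : 0 < M)
    {Q : ℝ[X]} (hQm : Q.Monic) (hQd : Q.natDegree = n + 1)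
    (hQo : ∀ G : ℝ[X], G.natDegree < n + 1 → ∑ l : Fin (N + 1), (Fin.cons M ν : Fin (N + 1) → ℝ) l * (Q * G).eval ((Fin.cons c w : Fin (N + 1) → ℝ) l) = 0) :
    Q = q (n + 1) - C (M * (q (n + 1)).eval c / (1 + M * (∑ k ∈ Finset.range (n + 1), C ((q k).eval c / ∑ l, ν l * ((q k).eval (w l)) ^ 2) * q k).eval c)) *
      ∑ k ∈ Finset.range (n + 1), C ((q k).eval c / ∑ l, ν l * ((q k).eval (w l)) ^ 2) * q k := by
  have hh : ∀ k, k ≤ n + 1 → ∑ l, ν l * ((q k).eval (w l)) ^ 2 ≠ 0 := fun k hk =>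
    (sum_mul_eval_sq_pos_of_natDegree_lt hν hw (hmonic k hk).ne_zero (by rw [hdeg k hk]; omega)).ne'
  -- the augmented measure is positive with distinct nodes
  have hν' : ∀ l : Fin (N + 1), 0 < (Fin.cons M ν : Fin (N + 1) → ℝ) l := fun l => by
    refine Fin.cases ?_ (fun i => ?_) l
    · simpa using hM
    · simpa using hν i
  have hw' : Function.Injective (Fin.cons c w : Fin (N + 1) → ℝ) := Fin.cons_injective_iff.2 ⟨fun h => by obtain ⟨l, hl⟩ := h; exact hc l hl, hw⟩
  -- `1 + M K_n(c,c) > 0`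
  have hKpos : 0 < (∑ k ∈ Finset.range (n + 1), C ((q k).eval c / ∑ l, ν l * ((q k).eval (w l)) ^ 2) * q k).eval c := by
    have hq0 : q 0 = 1 := eq_one_of_monic_natDegree_zero (hmonic 0 (Nat.zero_le _)) (hdeg 0 (Nat.zero_le _))
    exact kernelPoly_eval_self_pos hν hw (by omega) hq0 (fun k hk => hmonic k (by omega)) (fun k hk => hdeg k (by omega)) c
  have hden : 1 + M * (∑ k ∈ Finset.range (n + 1), C ((q k).eval c / ∑ l, ν l * ((q k).eval (w l)) ^ 2) * q k).eval c ≠ 0 := by positivity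
  obtain ⟨hPm, hPd⟩ := uvarov_monic_natDegree ν w hmonic hdeg c (M * (q (n + 1)).eval c / (1 + M * (∑ k ∈ Finset.range (n + 1), C ((q k).eval c / ∑ l, ν l * ((q k).eval (w l)) ^ 2) * q k).eval c))
  refine orthogonal_monic_unique hν' hw' (by omega) hQm hQd hPm hPd hQo fun G hG => ?_
  rw [sum_cons_measure, add_comm]
  exact uvarov_orthogonal hmonic hdeg horth hh le_rfl hden (by omega)

end Summit.Ventures.HSemireg.Wedge.HankelOuter
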